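import Summits.NavierStokesRegularity.NavierStokesRegularity.Theorems.TypeICertificateLadderTargetFiveHalvesWindowDepletedSliceAB
import Summits.NavierStokesRegularity.NavierStokesRegularity.Theorems.TypeICertificateLadderTargetFiveHalvesWindowSlabOfSlice
import Summits.NavierStokesRegularity.NavierStokesRegularity.Theorems.TypeICertificateLadderTargetFiveHalvesWindowDepletedRung

/-!
# Crux `Target` (stmt-NavierStokesRegularity-1217), line `depletion-ladder` at `q = 5/2`: RUNGS FROM
# TWO DEPLETION CONSTANTS — `X_C` for every `(κ_A² + κ_B²/2)·C² < 8/5`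

`--supports stmt-NavierStokesRegularity-1217`. With BOTH pairings of the `q = 5/2` budget depleted —
the weighted Lamb pairing (law `hlawA`, constant `κ_A`, as in `…DepletedRung.lean`) and the magnitude
pairing `∫τ⟪ω,(ω·∇)ω⟫⟪ω,v⟫`, `τ = wt/(2(|ω|²+1))` (law `hlawB`, constant `κ_B`; schema below,
Cauchy–Schwarz value `κ_B = 1` PROVED: `lawB_one`) — every rung `X_C` with `(κ_A² + κ_B²/2)·C² < 8/5`
holds (`rung_of_depletion_fiveHalvesAB`): two-piece slice `depletedSlice_curlAB` ⇒ generic slab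
`slab_of_slice` (`c = max((2κ_A²+κ_B²)/8, 7/(20C²))`) ⇒ `aprioriDecay_of_rate_coeff` ⇒ bootstrap
`zRate_bootstrapα` ⇒ `hasSmoothExtensionPast_of_decay`. This is the full coefficient
`q(κ_A² + (q−2)κ_B²)/4` of `TypeICertificateLadderTargetDepletedBudgetReach.lean` at `q = 5/2` as an
honest theorem about Navier–Stokes: at the numerical values `κ_A ≈ 0.135`, `κ_B ≈ 0.24`
(kit j270796, `--workitem 1217`) the reach would be `C < 5.8`; at `κ_A = κ_B = 1` it is the window
`C² < 16/15`. WHAT THIS IS NOT: no depletion constant `< 1` is proved here (S1 open). [folklore]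
-/

noncomputable section

open Set Filter Topology MeasureTheory
open scoped RealInnerProductSpace ENNReal NNReal Laplacian ContDiff
open Literature.Analysis.FluidPDE

namespace Summit.NavierStokesRegularity.NavierStokesRegularity.Theorems.FiveHalvesWindow

-- the problem directory `NavierStokesRegularity/NavierStokesRegularity` forces the duplicated namespace
set_option linter.dupNamespace false

open Summit.NavierStokesRegularity.NavierStokesRegularity.Theorems.RungReynoldsOne
open Summit.NavierStokesRegularity.NavierStokesRegularity.Theorems.RungReynoldsOne.WeightedSlice

/-- **The magnitude-pairing depletion law holds with `κ_B = 1`** (non-vacuity of `hlawB`): for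
`v ∈ C³` divergence free with `|v| ≤ M`, `‖Dv‖ ≤ B`, `Dv, D²v ∈ L²`, `ω = curl v`:
`|∫ τ⟪ω, Dω ω⟫⟪ω, v⟫| ≤ M (∫τ|ω|⁴)^{1/2} (∫τ Σᵢ⟪ω,∂ᵢω⟫²)^{1/2}` (Cauchy–Schwarz pointwise, Hölder;
all integrals finite since `τ|ω|² ≤ wt/2 ≤ W₀/2`). [folklore] -/
theorem lawB_one : ∀ (v : EuclideanSpace ℝ (Fin 3) → EuclideanSpace ℝ (Fin 3)) (M B : ℝ),
      ContDiff ℝ 3 v → VectorCalculus.IsDivFree v → (∀ x, ‖v x‖ ≤ M) →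
      (∀ x, ‖fderiv ℝ v x‖ ≤ B) →
      (∫⁻ x, ‖iteratedFDeriv ℝ 1 v x‖ₑ ^ 2 < ⊤) → (∫⁻ x, ‖iteratedFDeriv ℝ 2 v x‖ₑ ^ 2 < ⊤) →
      |∫ x, (‖curl v x‖ ^ 2 + 1) ^ (1 / 4 : ℝ) / (2 * (‖curl v x‖ ^ 2 + 1)) *
          (⟪curl v x, fderiv ℝ (curl v) x (curl v x)⟫ * ⟪curl v x, v x⟫)| ≤
        1 * M * Real.sqrt (∫ x, (‖curl v x‖ ^ 2 + 1) ^ (1 / 4 : ℝ) / (2 * (‖curl v x‖ ^ 2 + 1)) *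
            ‖curl v x‖ ^ 4) *
          Real.sqrt (∫ x, (‖curl v x‖ ^ 2 + 1) ^ (1 / 4 : ℝ) / (2 * (‖curl v x‖ ^ 2 + 1)) *
            ∑ i, ⟪curl v x, fderiv ℝ (curl v) x (EuclideanSpace.basisFun (Fin 3) ℝ i)⟫ ^ 2) := by
  intro v M B hv _hdiv hM hB h1 h2
  set e := EuclideanSpace.basisFun (Fin 3) ℝ with he
  have he1 : ∀ i, ‖e i‖ = 1 := fun i => by simp [he]
  have hM0 : 0 ≤ M := (norm_nonneg _).trans (hM 0)
  have hv2 : ContDiff ℝ 2 v := hv.of_le (by norm_cast)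
  have hDv : ContDiff ℝ 2 (fderiv ℝ v) := hv.fderiv_right (m := 2) (by norm_cast)
  have hω : ContDiff ℝ 2 (curl v) := by
    rw [curl_eq_curlCLM_comp]; exact curlCLM.contDiff.comp hDv
  have hω1 : ContDiff ℝ 1 (curl v) := hω.of_le (by norm_cast)
  have cω : Continuous (curl v) := hω.continuous
  have cDω : Continuous (fderiv ℝ (curl v)) := hω1.continuous_fderiv one_ne_zero
  have cDωe : ∀ i, Continuous fun x => fderiv ℝ (curl v) x (e i) := fun i =>
    cDω.clm_apply continuous_const
  have cv : Continuous v := hv.continuous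
  -- the weight is bounded
  set wt : EuclideanSpace ℝ (Fin 3) → ℝ := fun x => (‖curl v x‖ ^ 2 + 1) ^ (1 / 4 : ℝ) with hwtdef
  have hwt0 : ∀ x, 0 ≤ wt x := fun x => Real.rpow_nonneg (by positivity) _
  have nω : ∀ x, ‖curl v x‖ ≤ ‖curlCLM‖ * B := fun x =>
    (norm_curl_le v x).trans (mul_le_mul_of_nonneg_left (hB x) (norm_nonneg curlCLM))
  set W₀ : ℝ := (‖curlCLM‖ * B) ^ 2 + 1 with hW₀
  have hwt : ∀ x, wt x ≤ W₀ := fun x =>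
    (weight_le (curl v x)).trans (by
      have := pow_le_pow_left₀ (norm_nonneg _) (nω x) 2
      rw [hW₀]; linarith)
  have cwt : Continuous wt := ((cω.norm.pow 2).add continuous_const).rpow_const fun x => Or.inr (by norm_num)
  -- `ω, ∂ᵢω ∈ L²`
  have l2ω : ∫⁻ x, ‖curl v x‖ₑ ^ 2 < ⊤ := by
    refine lintegral_enorm_sq_lt_top_of_norm_le_const_mul ‖curlCLM‖ (fun x => ?_) h1
    rw [← norm_iteratedFDeriv_fderiv, norm_iteratedFDeriv_zero]
    exact norm_curl_le v x
  have l2dω : ∀ i, ∫⁻ x, ‖fderiv ℝ (curl v) x (e i)‖ₑ ^ 2 < ⊤ := fun i => by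
    refine lintegral_enorm_sq_lt_top_of_norm_le_const_mul ‖curlCLM‖ (fun x => ?_) h2
    calc ‖fderiv ℝ (curl v) x (e i)‖ ≤ ‖fderiv ℝ (curl v) x‖ := by
          simpa [he1] using (fderiv ℝ (curl v) x).le_opNorm (e i)
      _ ≤ ‖curlCLM‖ * ‖iteratedFDeriv ℝ 2 v x‖ := norm_fderiv_curl_le hv2 x
  -- the weight `τ = wt/(2(‖ω‖²+1))`
  set τ : EuclideanSpace ℝ (Fin 3) → ℝ := fun x =>
    (‖curl v x‖ ^ 2 + 1) ^ (1 / 4 : ℝ) / (2 * (‖curl v x‖ ^ 2 + 1)) with hτdef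
  have hτ0 : ∀ x, 0 ≤ τ x := fun x => by have := hwt0 x; rw [hτdef]; positivity
  have cτ : Continuous τ :=
    cwt.div (continuous_const.mul ((cω.norm.pow 2).add continuous_const)) fun x => by positivity
  have hτwt : ∀ x, τ x * ‖curl v x‖ ^ 2 ≤ wt x / 2 := fun x => by
    rw [hτdef]; simp only
    rw [div_mul_eq_mul_div, div_le_div_iff₀ (by positivity) (by norm_num)]
    nlinarith [hwt0 x, sq_nonneg ‖curl v x‖]
  -- the two Hölder factors `f = √τ ‖ω‖²`, `g = √τ √S`, `S = Σᵢ⟪ω, ∂ᵢω⟫²`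
  set A : EuclideanSpace ℝ (Fin 3) → ℝ := fun x => ∑ i, ‖fderiv ℝ (curl v) x (e i)‖ ^ 2 with hA
  set S : EuclideanSpace ℝ (Fin 3) → ℝ := fun x => ∑ i, ⟪curl v x, fderiv ℝ (curl v) x (e i)⟫ ^ 2
    with hS
  have hA0 : ∀ x, 0 ≤ A x := fun x => Finset.sum_nonneg fun i _ => sq_nonneg _
  have hS0 : ∀ x, 0 ≤ S x := fun x => Finset.sum_nonneg fun i _ => sq_nonneg _
  have hSA : ∀ x, S x ≤ ‖curl v x‖ ^ 2 * A x := fun x => by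
    rw [hS, hA]; simp only
    rw [Finset.mul_sum]
    refine Finset.sum_le_sum fun i _ => ?_
    have h := abs_real_inner_le_norm (curl v x) (fderiv ℝ (curl v) x (e i))
    have h' := pow_le_pow_left₀ (abs_nonneg _) h 2
    rw [sq_abs, mul_pow] at h'
    exact h'
  have cA : Continuous A := continuous_finsetSum _ fun i _ => (cDωe i).norm.pow 2
  have cS : Continuous S := continuous_finsetSum _ fun i _ => (cω.inner (cDωe i)).pow 2
  set f : EuclideanSpace ℝ (Fin 3) → ℝ := fun x => Real.sqrt (τ x) * ‖curl v x‖ ^ 2 with hf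
  set g : EuclideanSpace ℝ (Fin 3) → ℝ := fun x => Real.sqrt (τ x) * Real.sqrt (S x) with hg
  have hf0 : ∀ x, 0 ≤ f x := fun x => mul_nonneg (Real.sqrt_nonneg _) (sq_nonneg _)
  have hg0 : ∀ x, 0 ≤ g x := fun x => mul_nonneg (Real.sqrt_nonneg _) (Real.sqrt_nonneg _)
  have cf : Continuous f := (cτ.sqrt).mul (cω.norm.pow 2)
  have cg : Continuous g := (cτ.sqrt).mul cS.sqrt
  have hf2 : ∀ x, f x ^ 2 = τ x * ‖curl v x‖ ^ 4 := fun x => by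
    rw [hf]; simp only; rw [mul_pow, Real.sq_sqrt (hτ0 x)]; ring
  have hg2 : ∀ x, g x ^ 2 = τ x * S x := fun x => by
    rw [hg]; simp only; rw [mul_pow, Real.sq_sqrt (hτ0 x), Real.sq_sqrt (hS0 x)]
  -- integrability of `f²`, `g²`
  have isqω : Integrable (fun x => ‖curl v x‖ ^ 2) volume := integrable_sq_norm_of_lintegral_lt_top cω l2ω
  have isq : ∀ i, Integrable (fun x => ‖fderiv ℝ (curl v) x (e i)‖ ^ 2) volume := fun i =>
    integrable_sq_norm_of_lintegral_lt_top (cDωe i) (l2dω i)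
  have iA : Integrable A volume := integrable_finsetSum _ fun i _ => isq i
  have if2 : Integrable (fun x => f x ^ 2) volume := by
    refine Integrable.mono' (isqω.const_mul (W₀ / 2)) (cf.pow 2).aestronglyMeasurable
      (Eventually.of_forall fun x => ?_)
    rw [Real.norm_of_nonneg (sq_nonneg _), hf2]
    have h1 : τ x * ‖curl v x‖ ^ 4 = (τ x * ‖curl v x‖ ^ 2) * ‖curl v x‖ ^ 2 := by ring
    rw [h1]
    have h2 : τ x * ‖curl v x‖ ^ 2 ≤ W₀ / 2 := (hτwt x).trans (by linarith [hwt x])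
    exact mul_le_mul_of_nonneg_right h2 (sq_nonneg _)
  have ig2 : Integrable (fun x => g x ^ 2) volume := by
    refine Integrable.mono' (iA.const_mul (W₀ / 2)) (cg.pow 2).aestronglyMeasurable
      (Eventually.of_forall fun x => ?_)
    rw [Real.norm_of_nonneg (sq_nonneg _), hg2]
    have h2 : τ x * ‖curl v x‖ ^ 2 ≤ W₀ / 2 := (hτwt x).trans (by linarith [hwt x])
    calc τ x * S x ≤ τ x * (‖curl v x‖ ^ 2 * A x) := mul_le_mul_of_nonneg_left (hSA x) (hτ0 x)
      _ = (τ x * ‖curl v x‖ ^ 2) * A x := by ring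
      _ ≤ W₀ / 2 * A x := mul_le_mul_of_nonneg_right h2 (hA0 x)
  have mf : MemLp f 2 volume := (memLp_two_iff_integrable_sq cf.aestronglyMeasurable).2 if2
  have mg : MemLp g 2 volume := (memLp_two_iff_integrable_sq cg.aestronglyMeasurable).2 ig2
  -- pointwise bound `|τ ⟪ω, Dω ω⟫ ⟪ω, v⟫| ≤ M f g`
  have hpt : ∀ x, ‖τ x * (⟪curl v x, fderiv ℝ (curl v) x (curl v x)⟫ * ⟪curl v x, v x⟫)‖ ≤
      M * (f x * g x) := by
    intro x
    -- `|⟪ω, Dω ω⟫| ≤ ‖ω‖ √S`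
    have hLy : fderiv ℝ (curl v) x (curl v x) = ∑ i, ⟪e i, curl v x⟫ • fderiv ℝ (curl v) x (e i) := by
      conv_lhs => rw [← e.sum_repr' (curl v x)]
      rw [map_sum]
      simp_rw [map_smul]
    have hexp : ⟪curl v x, fderiv ℝ (curl v) x (curl v x)⟫ =
        ∑ i, ⟪e i, curl v x⟫ * ⟪curl v x, fderiv ℝ (curl v) x (e i)⟫ := by
      rw [hLy, inner_sum]
      simp_rw [real_inner_smul_right]
    have hCS : (∑ i, ⟪e i, curl v x⟫ * ⟪curl v x, fderiv ℝ (curl v) x (e i)⟫) ^ 2 ≤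
        (∑ i, ⟪e i, curl v x⟫ ^ 2) * ∑ i, ⟪curl v x, fderiv ℝ (curl v) x (e i)⟫ ^ 2 :=
      Finset.sum_mul_sq_le_sq_mul_sq _ _ _
    rw [e.sum_sq_inner_right (curl v x)] at hCS
    have hY : |⟪curl v x, fderiv ℝ (curl v) x (curl v x)⟫| ≤ ‖curl v x‖ * Real.sqrt (S x) := by
      refine abs_le_of_sq_le_sq ?_ (by positivity)
      rw [hexp, mul_pow, Real.sq_sqrt (hS0 x)]
      exact hCS
    have hZ : |⟪curl v x, v x⟫| ≤ ‖curl v x‖ * M :=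
      (abs_real_inner_le_norm _ _).trans (mul_le_mul_of_nonneg_left (hM x) (norm_nonneg _))
    rw [norm_mul, Real.norm_of_nonneg (hτ0 x), Real.norm_eq_abs, abs_mul]
    have hfg : f x * g x = τ x * (‖curl v x‖ ^ 2 * Real.sqrt (S x)) := by
      rw [hf, hg]; simp only
      rw [show Real.sqrt (τ x) * ‖curl v x‖ ^ 2 * (Real.sqrt (τ x) * Real.sqrt (S x)) =
        (Real.sqrt (τ x) * Real.sqrt (τ x)) * (‖curl v x‖ ^ 2 * Real.sqrt (S x)) by ring,
        Real.mul_self_sqrt (hτ0 x)]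
    rw [hfg]
    have hprod : |⟪curl v x, fderiv ℝ (curl v) x (curl v x)⟫| * |⟪curl v x, v x⟫| ≤
        (‖curl v x‖ * Real.sqrt (S x)) * (‖curl v x‖ * M) :=
      mul_le_mul hY hZ (abs_nonneg _) (by positivity)
    have e1 : (‖curl v x‖ * Real.sqrt (S x)) * (‖curl v x‖ * M) =
        M * (‖curl v x‖ ^ 2 * Real.sqrt (S x)) := by ring
    rw [e1] at hprod
    have := mul_le_mul_of_nonneg_left hprod (hτ0 x)
    nlinarith [this, hτ0 x]
  -- Hölder
  have hH := integral_mul_le_Lp_mul_Lq_of_nonneg (p := 2) (q := 2) (μ := volume)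
    (Real.HolderConjugate.two_two) (Eventually.of_forall hf0) (Eventually.of_forall hg0)
    (by simpa using mf) (by simpa using mg)
  have hfg_int : Integrable (fun x => f x * g x) volume := MemLp.integrable_mul mf mg
  calc |∫ x, τ x * (⟪curl v x, fderiv ℝ (curl v) x (curl v x)⟫ * ⟪curl v x, v x⟫)|
      = ‖∫ x, τ x * (⟪curl v x, fderiv ℝ (curl v) x (curl v x)⟫ * ⟪curl v x, v x⟫)‖ :=
        (Real.norm_eq_abs _).symm
    _ ≤ ∫ x, ‖τ x * (⟪curl v x, fderiv ℝ (curl v) x (curl v x)⟫ * ⟪curl v x, v x⟫)‖ :=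
        norm_integral_le_integral_norm _
    _ ≤ ∫ x, M * (f x * g x) :=
        integral_mono_of_nonneg (Eventually.of_forall fun x => norm_nonneg _)
          (hfg_int.const_mul M) (Eventually.of_forall hpt)
    _ = M * ∫ x, f x * g x := integral_const_mul _ _
    _ ≤ M * ((∫ x, f x ^ (2:ℝ)) ^ (1 / (2:ℝ)) * (∫ x, g x ^ (2:ℝ)) ^ (1 / (2:ℝ))) :=
        mul_le_mul_of_nonneg_left hH hM0
    _ = 1 * M * Real.sqrt (∫ x, τ x * ‖curl v x‖ ^ 4) * Real.sqrt (∫ x, τ x * S x) := by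
        rw [one_mul, Real.sqrt_eq_rpow, Real.sqrt_eq_rpow]
        have e1 : (∫ x, f x ^ (2:ℝ)) = ∫ x, τ x * ‖curl v x‖ ^ 4 :=
          integral_congr_ae (Eventually.of_forall fun x => by
            simp only; rw [Real.rpow_two, hf2])
        have e2 : (∫ x, g x ^ (2:ℝ)) = ∫ x, τ x * S x :=
          integral_congr_ae (Eventually.of_forall fun x => by
            simp only; rw [Real.rpow_two, hg2])
        rw [e1, e2]; ring

/-- **RUNGS FROM TWO `q = 5/2` DEPLETION CONSTANTS.** If the weighted Lamb pairing is depleted with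
constant `κ` and the magnitude pairing with constant `κB` on every admissible field, then for every
`C > 0` with `(κ² + κB²/2)·C² < 8/5` rung `X_C` holds: every classical Leray–Hopf
rapidly-decaying-datum solution on `ℝ³ × [0,T)` with eventual collapse Reynolds number
`√(T−t)‖u(t,x)‖ ≤ C√ν` extends smoothly past `T`. (`κB = 1`: `rung_of_depletion_fiveHalves`; `κ, κB → 0`: every `C`.) -/
theorem rung_of_depletion_fiveHalvesAB {κ κB : ℝ}
    (hlaw : ∀ (v : EuclideanSpace ℝ (Fin 3) → EuclideanSpace ℝ (Fin 3)) (M B : ℝ),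
      ContDiff ℝ 3 v → VectorCalculus.IsDivFree v → (∀ x, ‖v x‖ ≤ M) →
      (∀ x, ‖fderiv ℝ v x‖ ≤ B) →
      (∫⁻ x, ‖iteratedFDeriv ℝ 1 v x‖ₑ ^ 2 < ⊤) → (∫⁻ x, ‖iteratedFDeriv ℝ 2 v x‖ₑ ^ 2 < ⊤) →
      |∫ x, (‖curl v x‖ ^ 2 + 1) ^ (1 / 4 : ℝ) * ⟪fderiv ℝ (curl v) x (curl v x), v x⟫| ≤
        κ * M * Real.sqrt (∫ x, (‖curl v x‖ ^ 2 + 1) ^ (1 / 4 : ℝ) * ‖curl v x‖ ^ 2) *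
          Real.sqrt (∫ x, (‖curl v x‖ ^ 2 + 1) ^ (1 / 4 : ℝ) *
            ∑ i, ‖fderiv ℝ (curl v) x (EuclideanSpace.basisFun (Fin 3) ℝ i)‖ ^ 2))
    (hlawB : ∀ (v : EuclideanSpace ℝ (Fin 3) → EuclideanSpace ℝ (Fin 3)) (M B : ℝ),
      ContDiff ℝ 3 v → VectorCalculus.IsDivFree v → (∀ x, ‖v x‖ ≤ M) →
      (∀ x, ‖fderiv ℝ v x‖ ≤ B) →
      (∫⁻ x, ‖iteratedFDeriv ℝ 1 v x‖ₑ ^ 2 < ⊤) → (∫⁻ x, ‖iteratedFDeriv ℝ 2 v x‖ₑ ^ 2 < ⊤) →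
      |∫ x, (‖curl v x‖ ^ 2 + 1) ^ (1 / 4 : ℝ) / (2 * (‖curl v x‖ ^ 2 + 1)) *
          (⟪curl v x, fderiv ℝ (curl v) x (curl v x)⟫ * ⟪curl v x, v x⟫)| ≤
        κB * M * Real.sqrt (∫ x, (‖curl v x‖ ^ 2 + 1) ^ (1 / 4 : ℝ) / (2 * (‖curl v x‖ ^ 2 + 1)) *
            ‖curl v x‖ ^ 4) *
          Real.sqrt (∫ x, (‖curl v x‖ ^ 2 + 1) ^ (1 / 4 : ℝ) / (2 * (‖curl v x‖ ^ 2 + 1)) *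
            ∑ i, ⟪curl v x, fderiv ℝ (curl v) x (EuclideanSpace.basisFun (Fin 3) ℝ i)⟫ ^ 2))
    {C : ℝ} (hC0 : 0 < C) (hC : (κ ^ 2 + κB ^ 2 / 2) * C ^ 2 < 8 / 5) :
    ∀ (ν T : ℝ), 0 < ν → 0 < T →
      ∀ (u : ℝ → EuclideanSpace ℝ (Fin 3) → EuclideanSpace ℝ (Fin 3))
        (p : ℝ → EuclideanSpace ℝ (Fin 3) → ℝ),
      IsClassicalNSSolutionOn (Set.Ico 0 T) ν 0 u p → IsLerayHopfOn T ν 0 (u 0) u →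
      HasRapidSpatialDecay (u 0) →
      (∀ᶠ t in 𝓝[<] T, ∀ x, Real.sqrt (T - t) * ‖u t x‖ ≤ C * Real.sqrt ν) →
      HasSmoothExtensionPast ν 0 u T := by
  intro ν T hν hT u p hcl hLH hdec hrate
  by_cases hC1 : C ≤ 1
  · -- rate at most `√ν`: rung one
    have hrate1 : ∀ᶠ t in 𝓝[<] T, ∀ x, Real.sqrt (T - t) * ‖u t x‖ ≤ Real.sqrt ν := by
      filter_upwards [hrate] with t ht x
      exact (ht x).trans (by nlinarith [Real.sqrt_nonneg ν])
    exact typeICertificateLadder_rungReynoldsOne ν T hν hT u p hcl hLH hdec hrate1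
  · have hC1' : 1 < C := not_le.1 hC1
    have hC2 : 1 < C ^ 2 := by nlinarith
    -- the slab coefficient `c = max((2κ²+κB²)/8, 7/(20C²))`, `α = 5cC²/2 ∈ [7/8, 1)`
    set c : ℝ := max ((2 * κ ^ 2 + κB ^ 2) / 8) (7 / (20 * C ^ 2)) with hcdef
    have hc : (2 * κ ^ 2 + κB ^ 2) / 8 ≤ c := le_max_left _ _
    have hc0 : 0 ≤ c := le_trans (by positivity) hc
    have hC20 : 0 < C ^ 2 := by positivity
    have hα34 : 3 / 4 < 5 * c * C ^ 2 / 2 := by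
      have h7 : 7 / (20 * C ^ 2) ≤ c := le_max_right _ _
      have h7' : 7 / 20 ≤ c * C ^ 2 := by
        have h := (div_le_iff₀ (by positivity : (0:ℝ) < 20 * C ^ 2)).1 h7
        nlinarith
      linarith
    have hα1 : 5 * c * C ^ 2 / 2 < 1 := by
      rcases le_total ((2 * κ ^ 2 + κB ^ 2) / 8) (7 / (20 * C ^ 2)) with h | h
      · have hc' : c = 7 / (20 * C ^ 2) := max_eq_right h
        rw [hc']
        field_simp
        nlinarith
      · have hc' : c = (2 * κ ^ 2 + κB ^ 2) / 8 := max_eq_left h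
        rw [hc']
        nlinarith
    have hαC : 2 * (5 * c * C ^ 2 / 2) - 3 / 2 ≤ C ^ 2 / 2 := by linarith
    obtain ⟨K₁, K₂, M, hb⟩ := aprioriDecay_of_rate_coeff hc0
      (fun _ν _T hν hT _u _p hsol hu hut hp _s hs hfin =>
        Target.Negative.lintegral_frobeniusNormSq_le_exp_half_linfty hν hT hsol hu hut hp hs hfin)
      (slab_of_slice hc0 (fun _ν hν' _v _W hv hW hdiv hcurl _M _B hM hB h1 h2 h3 _h4 =>
          depletedSlice_curlAB hν' hc hv hdiv hcurl hM hB h1 h2 h3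
            (hlaw _ _ _ (hv.of_le (by norm_cast)) hdiv hM hB h1 h2)
            (hlawB _ _ _ (hv.of_le (by norm_cast)) hdiv hM hB h1 h2))
        stub_weightedVorticityBalance)
      stub_taoCover hν hT hC0 hcl hLH hdec hrate
    obtain ⟨n, hn⟩ := exists_bootExpα_lt_half hα1 hαC
    obtain ⟨-, ⟨K, hK⟩⟩ := zRate_bootstrapα hν hT hcl hLH hdec hα34 hαC hb n
    exact hasSmoothExtensionPast_of_decay hν hT hcl hLH hdec hn ⟨by linarith, by linarith⟩ hK


/-- Consistency (`example`): with both laws at their Cauchy–Schwarz values (`law_one`, `lawB_one`)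
the two-piece rung theorem re-derives the window `(1 + 1/2)C² < 8/5`, i.e. `C² < 16/15`. -/
example {C : ℝ} (hC0 : 0 < C) (hC : C ^ 2 < 16 / 15) :
    ∀ (ν T : ℝ), 0 < ν → 0 < T →
      ∀ (u : ℝ → EuclideanSpace ℝ (Fin 3) → EuclideanSpace ℝ (Fin 3))
        (p : ℝ → EuclideanSpace ℝ (Fin 3) → ℝ),
      IsClassicalNSSolutionOn (Set.Ico 0 T) ν 0 u p → IsLerayHopfOn T ν 0 (u 0) u →
      HasRapidSpatialDecay (u 0) →
      (∀ᶠ t in 𝓝[<] T, ∀ x, Real.sqrt (T - t) * ‖u t x‖ ≤ C * Real.sqrt ν) →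
      HasSmoothExtensionPast ν 0 u T :=
  rung_of_depletion_fiveHalvesAB (κ := 1) (κB := 1) law_one lawB_one hC0 (by nlinarith)

/-- The two-constant reach at the numerically observed values `κ_A = 0.135`, `κ_B = 0.24`
(kit j270796): `(κ_A² + κ_B²/2)·C² < 8/5` holds up to `C = 5.8`. -/
theorem reach_of_two_depletions_example :
    ((0.135 : ℝ) ^ 2 + (0.24 : ℝ) ^ 2 / 2) * (5.8 : ℝ) ^ 2 < 8 / 5 := by norm_num

end Summit.NavierStokesRegularity.NavierStokesRegularity.Theorems.FiveHalvesWindow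

end
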